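import Summits.CriticalPhenomena.PercolationContinuityZ3.Theses.PercExchangeRateTransport

/-!
# Line `birth` — registered skeleton (BC3) for the crux `SubcritExchangeUniformity`
# (stmt-CriticalPhenomena-16062, route `PercExchangeRateTransport`, rank 3, "K⁻")

Crux (fixed, by name): `PercExchangeRateTransport.SubcritExchangeUniformity` — K⁻, the subcritical
half of the exchange-rate hypothesis of the transport route. Objects (the crux's own `let`s): i.i.d.
uniform labels `U` on the bonds of `ℤ³` (law `labelMeasure (Site 3)`), the two-parameter family on
`ℤ²×ℤ` in which an `x`/`y`-bond is open iff `U ≤ p` and a `z`-bond iff `U ≤ t`, the box one-arm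
polynomials `Θ_n(p,t) = P(0 ↔ ∂Λ_n)`, `θ(p,t) = P(|C(0)| = ∞)`, the critical curve
`p_c(t) = inf {p ∈ [0,1] : θ(p,t) > 0} ∪ {1}`, and the two Russo intensities
`∂_tΘ_n = deriv (fun s => Θ n p s) t`, `∂_pΘ_n = deriv (fun q => Θ n q t) p` whose ratio
`a_n := ∂_tΘ_n / ∂_pΘ_n` is the finite-volume EXCHANGE RATE. K⁻ says: for every compact sub-arc
`[lo,hi] ⊂ (0,1)` there is a continuous `σ` on `[lo,hi]` such that for every `η > 0` there are
`δ > 0`, `m` with `|∂_tΘ_n(p,t) − σ(t) ∂_pΘ_n(p,t)| ≤ η ∂_pΘ_n(p,t)` for all `n ≥ m`, `t ∈ [lo,hi]`,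
`p_c(t) − δ ≤ p ≤ p_c(t)` — i.e. `a_n(p,t) → σ(t)` in the JOINT limit `n → ∞`, `p ↑ p_c(t)`,
uniformly in `t`.

THE LINE ("centre + equicontinuity": the Moore–Osgood split of that joint limit into its two
iterated halves, each a differently-flavoured open statement, glued by a positivity fact):

* `stub_curveRatioLimit` (OPEN, load-bearing — the CRITICAL-WINDOW content, at window coordinate
  `x = 0`): ON the curve the exchange rate converges, `a_n(p_c(t),t) → σ(t)` uniformly on `[lo,hi]`,
  with `σ` continuous (multiplied-out form `|∂_tΘ_n − σ ∂_pΘ_n| ≤ η ∂_pΘ_n` at `p = p_c(t)`). This is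
  the `x = 0` slice of the route's foreseen shared child `WindowRatioLimit` (TWO-LAYER PLAN of
  `Theses/PercExchangeRateTransport.lean`). Why plausibly true: by Russo `∂_tΘ_n`, `∂_pΘ_n` are the
  expected numbers of pivotal `z`-bonds and of pivotal `x,y`-bonds for `{0 ↔ ∂Λ_n}`; in the
  analytic-scaling-field picture (Wegner / Aharony–Fisher, doi:10.1103/PhysRevB.27.4394)
  `Θ_n ≈ A(p,t) n^{−x} F(u(p,t) n^{1/ν})` with a smooth relevant field `u` vanishing on the curve, so
  `a_n = ∂_t u/∂_p u + O(n^{−1/ν}) + O(n^{−ω}) → −p_c′(t)`; at the isotropic point `t = p_c(ℤ³)` it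
  holds trivially (`a_n ≡ 1/2` on the diagonal by cubic symmetry). Why it might fail: it is a
  ratio-limit theorem for two critical pivotal intensities with no RSW / quasi-multiplicativity in
  3D (the 2D prototype is GarbanPeteSchramm2013Pivotal §4–5); a log-periodic (discrete-scale-
  invariance) modulation of the critical pivotal counts would make `a_n(p_c(t),t)` oscillate in `n`.
* `stub_subcritRatioEquicontinuity` (OPEN, load-bearing — LOWER-WINDOW FLATNESS + ORNSTEIN–ZERNIKE
  CROSSOVER): uniform-in-`n` equicontinuity of the exchange rate from below at the curve,
  `|a_n(p,t) − a_n(p_c(t),t)| ≤ η` for `n ≥ m(η)`, `p_c(t) − δ(η) ≤ p ≤ p_c(t)`, in the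
  cross-multiplied form `|∂_tΘ_n(p,t) ∂_pΘ_n(p_c(t),t) − ∂_tΘ_n(p_c(t),t) ∂_pΘ_n(p,t)| ≤
  η ∂_pΘ_n(p,t) ∂_pΘ_n(p_c(t),t)` (no division, no junk values). It comprises the route's foreseen
  child `SubcritOffWindow`: deep in the strip (`p_c(t) − p ≫ n^{−1/ν}`) `Θ_n ≈ e^{−n m_F(p,t)}` for the
  cheapest face `F` of `Λ_n` (FACE SELECTION) and `a_n → ∂_t m_F/∂_p m_F = ∂_t u/∂_p u + O(|u|)`, a
  direction-dependent `O(dist)` germ that must be `o(1)` as `p ↑ p_c(t)` uniformly in `n`; inside the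
  window it is flatness of the profile `x ↦ a_n(p_c(t) + x n^{−1/ν}, t)` on `x ≤ 0`. Why it might
  fail: the crossover from the critical window to the Ornstein–Zernike string regime
  (CampaninoIoffeVelenik2008, fixed `(p,t)` only) is uncontrolled even in `d = 2`; a germ that does
  not flatten (persistent `O(1)` `x`-dependence of the window profile) kills it — this is exactly the
  crux's recorded failure mode, now isolated from the convergence question of stub 1.
* `stub_slopePositiveOnCurve` (by-name SUPPORT, provable from the route items `ModelFacts` ∧
  `CriticalCurveRegular` — the derivation `slopePositiveOnCurve_of_items` is proved below; from
  scratch it is Russo's formula for the label coupling plus `0 < p_c(t) < 1`, size L):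
  `0 < ∂_pΘ_n(p_c(t),t)` for `n ≥ 1`, `t ∈ [lo,hi]` (the straight `x`-path is pivotal with positive
  probability). It is what lets the two multiplied-out inequalities be divided.
* `SubcritExchangeUniformity_of : Sig.stub_curveRatioLimit → Sig.stub_subcritRatioEquicontinuity →
  Sig.stub_slopePositiveOnCurve → SubcritExchangeUniformity` (hypotheses the stub `Prop`s BY NAME,
  conclusion the route decl BY NAME; real proof): take `σ` from stub 1; given `η`, run stubs 1 and 2
  at `η/2`; with `D = ∂_pΘ_n(p_c(t),t) > 0` (stub 3), `d = ∂_pΘ_n(p,t)`, `T = ∂_tΘ_n(p_c(t),t)`,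
  `τ = ∂_tΘ_n(p,t)`: stub 2 forces `d ≥ 0`, and
  `|τ − σ d|·D = |(τD − Td) + d(T − σD)| ≤ (η/2) d D + d (η/2) D = η d D`; divide by `D`.
  The percolation-free core is `ratio_glue` (abstract `dT, dP, pc`).

SEPARATION (why this is a split and not a costume). K⁻ ⟹ stub 1 (take `p = p_c(t)`) and, given
stub 3, K⁻ ⟹ stub 2 (triangle inequality) — both stubs are CONSEQUENCES of the crux, strictly
weaker: stub 1 says nothing below the curve; stub 2 allows `a_n(p_c(t),t)` to oscillate in `n`
forever (a discrete-scale-invariance world satisfies stub 2 and violates stub 1 and K⁻); stub 3 is a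
positivity fact. Neither stub implies the crux or the conjunct `θ_{ℤ³}(p_c) = 0` cheaply: BC3 probes
`stub → SubcritExchangeUniformity`, `stub → _root_.PercolationContinuityZ3` by
`first | exact? | simpa [S] | (unfold S; simpa) | aesop` fail for all three (files
`bc/stub_*_probe.lean` of the registering session).

DISPROOF USED: none exists for this item (`ledger crux ls stmt-CriticalPhenomena-16062`: no
workfiles, 2026-08-17; no `_false_without_` theorem, no landed `Negative/` lemma). Negatives index
(`ledger negatives --problem CriticalPhenomena`): nothing on exchange rates / pivotal intensities /
anisotropic critical curves (route header: 10 statements, 3 on this sub — TiltGluing,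
CoverIsCovering, QuarantineInequality — untouched). Dead lines: none recorded for this crux.

Degenerate parameters: `t ∈ [lo,hi] ⊂ (0,1)`; `p = p_c(t) ∈ (0,1)` in stubs 1, 3 (route item
`CriticalCurveRegular`); in stub 2, `δ` is existential, so the prover may keep `p > 0` (for `p ≤ 0`
the horizontal intensity vanishes while the vertical one does not, and the inequality would fail —
`δ < inf_{[lo,hi]} p_c` is part of the statement's content, as it is for the crux); `n = 0`
(`Θ_0 ≡ 1`, both intensities `0`) is excluded from stub 3 by `1 ≤ n` and is harmless in stubs 1–2
(`0 ≤ 0`). `deriv` junk (value `0` where not differentiable) never occurs on the open square, where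
each `Θ_n` is a polynomial (route item `ModelFacts`).
-/

noncomputable section

namespace Summit.CriticalPhenomena.PercolationContinuityZ3.Cruxes.SubcritExchangeUniformity.Birth

open MeasureTheory
open Literature.Probability.Percolation Literature.Probability.LatticeModels
open Summit.CriticalPhenomena.PercolationContinuityZ3.Theses.PercExchangeRateTransport
  (SubcritExchangeUniformity ModelFacts CriticalCurveRegular)

/-! ## §0 Objects of the line (the crux's own `let`s, named) -/

/-- The law of the i.i.d. uniform labels on the bonds of `ℤ³`. -/
abbrev μ : Measure (Sym2 (Site 3) → ℝ) := labelMeasure (Site 3)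

/-- `e` is a vertical (`z`-) bond: `e = {x, x + e₃}`. -/
def IsVert (e : Sym2 (Site 3)) : Prop := ∃ x : Site 3, e = s(x, x + Pi.single (2 : Fin 3) 1)

/-- The label-coupled anisotropic configuration at `(p,t)`: horizontal bonds open iff `U ≤ p`,
vertical bonds iff `U ≤ t`. -/
def cfgPT (p t : ℝ) (U : Sym2 (Site 3) → ℝ) : Set (Sym2 (Site 3)) :=
  {e | e ∈ (zdGraph 3).edgeSet ∧ ((IsVert e ∧ U e ≤ t) ∨ (¬ IsVert e ∧ U e ≤ p))}

/-- `Θ_n(p,t) = P(0 ↔ ∂Λ_n)`. -/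
def ThetaBox (n : ℕ) (p t : ℝ) : ℝ := μ.real {U | cfgPT p t U ∈ siteToBoundary 3 n}

/-- `θ(p,t) = P(|C(0)| = ∞)`. -/
def thetaPerc (p t : ℝ) : ℝ := μ.real {U | cfgPT p t U ∈ percolatesAt (0 : Site 3)}

/-- The anisotropic critical curve `p_c(t)`. -/
def pcurve (t : ℝ) : ℝ := sInf ({p : ℝ | 0 ≤ p ∧ p ≤ 1 ∧ 0 < thetaPerc p t} ∪ {1})

/-- `∂_pΘ_n(p,t)`, the horizontal Russo intensity. -/
def dP (n : ℕ) (p t : ℝ) : ℝ := deriv (fun q => ThetaBox n q t) p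

/-- `∂_tΘ_n(p,t)`, the vertical Russo intensity. -/
def dT (n : ℕ) (p t : ℝ) : ℝ := deriv (fun s => ThetaBox n p s) t

/-- The crux, literally, over the local names (by `Iff.rfl`). -/
theorem subcritExchangeUniformity_iff :
    SubcritExchangeUniformity ↔
      ∀ lo hi : ℝ, 0 < lo → lo < hi → hi < 1 → ∃ σ : ℝ → ℝ, ContinuousOn σ (Set.Icc lo hi) ∧
        ∀ η > (0 : ℝ), ∃ δ > (0 : ℝ), ∃ m : ℕ, ∀ n ≥ m, ∀ t ∈ Set.Icc lo hi, ∀ p : ℝ,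
          pcurve t - δ ≤ p → p ≤ pcurve t →
            |dT n p t - σ t * dP n p t| ≤ η * dP n p t :=
  Iff.rfl

/-! ## §1 The three stub statements — readable local form -/

/-- STUB 1 statement: on-curve exchange-rate limit, uniform on compact sub-arcs, continuous limit. -/
def CurveRatioLimit : Prop :=
  ∀ lo hi : ℝ, 0 < lo → lo < hi → hi < 1 → ∃ σ : ℝ → ℝ, ContinuousOn σ (Set.Icc lo hi) ∧
    ∀ η > (0 : ℝ), ∃ m : ℕ, ∀ n ≥ m, ∀ t ∈ Set.Icc lo hi,
      |dT n (pcurve t) t - σ t * dP n (pcurve t) t| ≤ η * dP n (pcurve t) t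

/-- STUB 2 statement: uniform-in-`n` equicontinuity of the exchange rate from below at the curve
(cross-multiplied). -/
def SubcritRatioEquicontinuity : Prop :=
  ∀ lo hi : ℝ, 0 < lo → lo < hi → hi < 1 →
    ∀ η > (0 : ℝ), ∃ δ > (0 : ℝ), ∃ m : ℕ, ∀ n ≥ m, ∀ t ∈ Set.Icc lo hi, ∀ p : ℝ,
      pcurve t - δ ≤ p → p ≤ pcurve t →
        |dT n p t * dP n (pcurve t) t - dT n (pcurve t) t * dP n p t| ≤
          η * dP n p t * dP n (pcurve t) t

/-- STUB 3 statement: the horizontal Russo intensity is positive at the curve. -/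
def SlopePositiveOnCurve : Prop :=
  ∀ lo hi : ℝ, 0 < lo → lo < hi → hi < 1 → ∀ n : ℕ, 1 ≤ n → ∀ t ∈ Set.Icc lo hi,
    0 < dP n (pcurve t) t

/-! ### Name-keyed, DEFINITION-FREE forms (what `SubcritExchangeUniformity_of` takes; restatable
verbatim in a `--supports` file: the `let` preamble is the crux's own) -/

namespace Sig

/-- Name-keyed statement of `stub_curveRatioLimit`, definition-free. [stub statement; open] -/
def stub_curveRatioLimit : Prop :=
  let μ := labelMeasure (Site 3)
  let vert : Sym2 (Site 3) → Prop := fun e => ∃ x : Site 3, e = s(x, x + Pi.single (2 : Fin 3) 1)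
  let cfg : ℝ → ℝ → (Sym2 (Site 3) → ℝ) → Set (Sym2 (Site 3)) := fun p t U =>
    {e | e ∈ (zdGraph 3).edgeSet ∧ ((vert e ∧ U e ≤ t) ∨ (¬ vert e ∧ U e ≤ p))}
  let Θ : ℕ → ℝ → ℝ → ℝ := fun n p t => μ.real {U | cfg p t U ∈ siteToBoundary 3 n}
  let θ : ℝ → ℝ → ℝ := fun p t => μ.real {U | cfg p t U ∈ percolatesAt (0 : Site 3)}
  let pc : ℝ → ℝ := fun t => sInf ({p : ℝ | 0 ≤ p ∧ p ≤ 1 ∧ 0 < θ p t} ∪ {1})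
  ∀ lo hi : ℝ, 0 < lo → lo < hi → hi < 1 → ∃ σ : ℝ → ℝ, ContinuousOn σ (Set.Icc lo hi) ∧
    ∀ η > (0 : ℝ), ∃ m : ℕ, ∀ n ≥ m, ∀ t ∈ Set.Icc lo hi,
      |deriv (fun s => Θ n (pc t) s) t - σ t * deriv (fun q => Θ n q t) (pc t)| ≤
        η * deriv (fun q => Θ n q t) (pc t)

/-- Name-keyed statement of `stub_subcritRatioEquicontinuity`, definition-free.
[stub statement; open] -/
def stub_subcritRatioEquicontinuity : Prop :=
  let μ := labelMeasure (Site 3)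
  let vert : Sym2 (Site 3) → Prop := fun e => ∃ x : Site 3, e = s(x, x + Pi.single (2 : Fin 3) 1)
  let cfg : ℝ → ℝ → (Sym2 (Site 3) → ℝ) → Set (Sym2 (Site 3)) := fun p t U =>
    {e | e ∈ (zdGraph 3).edgeSet ∧ ((vert e ∧ U e ≤ t) ∨ (¬ vert e ∧ U e ≤ p))}
  let Θ : ℕ → ℝ → ℝ → ℝ := fun n p t => μ.real {U | cfg p t U ∈ siteToBoundary 3 n}
  let θ : ℝ → ℝ → ℝ := fun p t => μ.real {U | cfg p t U ∈ percolatesAt (0 : Site 3)}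
  let pc : ℝ → ℝ := fun t => sInf ({p : ℝ | 0 ≤ p ∧ p ≤ 1 ∧ 0 < θ p t} ∪ {1})
  ∀ lo hi : ℝ, 0 < lo → lo < hi → hi < 1 →
    ∀ η > (0 : ℝ), ∃ δ > (0 : ℝ), ∃ m : ℕ, ∀ n ≥ m, ∀ t ∈ Set.Icc lo hi, ∀ p : ℝ,
      pc t - δ ≤ p → p ≤ pc t →
        |deriv (fun s => Θ n p s) t * deriv (fun q => Θ n q t) (pc t) -
            deriv (fun s => Θ n (pc t) s) t * deriv (fun q => Θ n q t) p| ≤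
          η * deriv (fun q => Θ n q t) p * deriv (fun q => Θ n q t) (pc t)

/-- Name-keyed statement of `stub_slopePositiveOnCurve`, definition-free.
[stub statement; by-name support — follows from the route items `ModelFacts`,
`CriticalCurveRegular`, see `slopePositiveOnCurve_of_items`] -/
def stub_slopePositiveOnCurve : Prop :=
  let μ := labelMeasure (Site 3)
  let vert : Sym2 (Site 3) → Prop := fun e => ∃ x : Site 3, e = s(x, x + Pi.single (2 : Fin 3) 1)
  let cfg : ℝ → ℝ → (Sym2 (Site 3) → ℝ) → Set (Sym2 (Site 3)) := fun p t U =>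
    {e | e ∈ (zdGraph 3).edgeSet ∧ ((vert e ∧ U e ≤ t) ∨ (¬ vert e ∧ U e ≤ p))}
  let Θ : ℕ → ℝ → ℝ → ℝ := fun n p t => μ.real {U | cfg p t U ∈ siteToBoundary 3 n}
  let θ : ℝ → ℝ → ℝ := fun p t => μ.real {U | cfg p t U ∈ percolatesAt (0 : Site 3)}
  let pc : ℝ → ℝ := fun t => sInf ({p : ℝ | 0 ≤ p ∧ p ≤ 1 ∧ 0 < θ p t} ∪ {1})
  ∀ lo hi : ℝ, 0 < lo → lo < hi → hi < 1 → ∀ n : ℕ, 1 ≤ n → ∀ t ∈ Set.Icc lo hi,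
    0 < deriv (fun q => Θ n q t) (pc t)

end Sig

/-- The name-keyed form of STUB 1 is the local form. -/
theorem Sig.stub_curveRatioLimit_iff : Sig.stub_curveRatioLimit ↔ CurveRatioLimit := Iff.rfl

/-- The name-keyed form of STUB 2 is the local form. -/
theorem Sig.stub_subcritRatioEquicontinuity_iff :
    Sig.stub_subcritRatioEquicontinuity ↔ SubcritRatioEquicontinuity := Iff.rfl

/-- The name-keyed form of STUB 3 is the local form. -/
theorem Sig.stub_slopePositiveOnCurve_iff :
    Sig.stub_slopePositiveOnCurve ↔ SlopePositiveOnCurve := Iff.rfl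

/-! ## §2 Registered stubs (the only `sorry`s of the file) -/

/-- **STUB 1 `curveRatioLimit`** (OPEN — LOAD-BEARING; the critical-window ratio limit at window
coordinate `x = 0`). For every compact sub-arc `[lo,hi] ⊂ (0,1)` there is `σ` continuous on
`[lo,hi]` with: for every `η > 0` there is `m` such that for all `n ≥ m`, `t ∈ [lo,hi]`,
`|∂_tΘ_n(p_c(t),t) − σ(t) ∂_pΘ_n(p_c(t),t)| ≤ η ∂_pΘ_n(p_c(t),t)` — the exchange rate of pivotal
`z`-bonds against pivotal `x,y`-bonds AT the critical curve converges, uniformly along the arc, to a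
continuous function (K⁺ ∧ K⁻ then identify `σ = −p_c′`). Size: open-problem (critical 3D pivotal
intensities; 2D prototype GarbanPeteSchramm2013Pivotal). Why it might fail: see module docstring.
[GarbanPeteSchramm2013Pivotal; AizenmanGrimmett1991; doi:10.1103/PhysRevB.27.4394;
Grimmett1999 §2.4 (Russo)] -/
theorem stub_curveRatioLimit :
    let μ := labelMeasure (Site 3)
    let vert : Sym2 (Site 3) → Prop := fun e => ∃ x : Site 3, e = s(x, x + Pi.single (2 : Fin 3) 1)
    let cfg : ℝ → ℝ → (Sym2 (Site 3) → ℝ) → Set (Sym2 (Site 3)) := fun p t U =>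
      {e | e ∈ (zdGraph 3).edgeSet ∧ ((vert e ∧ U e ≤ t) ∨ (¬ vert e ∧ U e ≤ p))}
    let Θ : ℕ → ℝ → ℝ → ℝ := fun n p t => μ.real {U | cfg p t U ∈ siteToBoundary 3 n}
    let θ : ℝ → ℝ → ℝ := fun p t => μ.real {U | cfg p t U ∈ percolatesAt (0 : Site 3)}
    let pc : ℝ → ℝ := fun t => sInf ({p : ℝ | 0 ≤ p ∧ p ≤ 1 ∧ 0 < θ p t} ∪ {1})
    ∀ lo hi : ℝ, 0 < lo → lo < hi → hi < 1 → ∃ σ : ℝ → ℝ, ContinuousOn σ (Set.Icc lo hi) ∧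
      ∀ η > (0 : ℝ), ∃ m : ℕ, ∀ n ≥ m, ∀ t ∈ Set.Icc lo hi,
        |deriv (fun s => Θ n (pc t) s) t - σ t * deriv (fun q => Θ n q t) (pc t)| ≤
          η * deriv (fun q => Θ n q t) (pc t) := by
  sorry

/-- **STUB 2 `subcritRatioEquicontinuity`** (OPEN — LOAD-BEARING; lower-window flatness +
Ornstein–Zernike crossover). For every compact sub-arc `[lo,hi] ⊂ (0,1)` and `η > 0` there are
`δ > 0`, `m` such that for all `n ≥ m`, `t ∈ [lo,hi]`, `p_c(t) − δ ≤ p ≤ p_c(t)`: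
`|∂_tΘ_n(p,t) ∂_pΘ_n(p_c(t),t) − ∂_tΘ_n(p_c(t),t) ∂_pΘ_n(p,t)| ≤ η ∂_pΘ_n(p,t) ∂_pΘ_n(p_c(t),t)`,
i.e. `|a_n(p,t) − a_n(p_c(t),t)| ≤ η`: approaching the curve from the subcritical side the exchange
rate forgets `p` uniformly in `n` (no face-selection jump survives at the curve; the `O(dist)` germ
of `∂_t m_F/∂_p m_F` is `o(1)` uniformly). Size: open-problem (OZ crossover uncontrolled even in
`d = 2`). Why it might fail: see module docstring. [CampaninoIoffeVelenik2008;
GarbanPeteSchramm2013Pivotal; AizenmanGrimmett1991; arXiv:0712.3412; Grimmett1999 §6.2] -/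
theorem stub_subcritRatioEquicontinuity :
    let μ := labelMeasure (Site 3)
    let vert : Sym2 (Site 3) → Prop := fun e => ∃ x : Site 3, e = s(x, x + Pi.single (2 : Fin 3) 1)
    let cfg : ℝ → ℝ → (Sym2 (Site 3) → ℝ) → Set (Sym2 (Site 3)) := fun p t U =>
      {e | e ∈ (zdGraph 3).edgeSet ∧ ((vert e ∧ U e ≤ t) ∨ (¬ vert e ∧ U e ≤ p))}
    let Θ : ℕ → ℝ → ℝ → ℝ := fun n p t => μ.real {U | cfg p t U ∈ siteToBoundary 3 n}
    let θ : ℝ → ℝ → ℝ := fun p t => μ.real {U | cfg p t U ∈ percolatesAt (0 : Site 3)}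
    let pc : ℝ → ℝ := fun t => sInf ({p : ℝ | 0 ≤ p ∧ p ≤ 1 ∧ 0 < θ p t} ∪ {1})
    ∀ lo hi : ℝ, 0 < lo → lo < hi → hi < 1 →
      ∀ η > (0 : ℝ), ∃ δ > (0 : ℝ), ∃ m : ℕ, ∀ n ≥ m, ∀ t ∈ Set.Icc lo hi, ∀ p : ℝ,
        pc t - δ ≤ p → p ≤ pc t →
          |deriv (fun s => Θ n p s) t * deriv (fun q => Θ n q t) (pc t) -
              deriv (fun s => Θ n (pc t) s) t * deriv (fun q => Θ n q t) p| ≤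
            η * deriv (fun q => Θ n q t) p * deriv (fun q => Θ n q t) (pc t) := by
  sorry

/-- **STUB 3 `slopePositiveOnCurve`** (by-name SUPPORT; S given the route items `ModelFacts` ∧
`CriticalCurveRegular` — `slopePositiveOnCurve_of_items` below — L from scratch: Russo's formula
for the label coupling and `0 < p_c(t) < 1`). For every compact sub-arc `[lo,hi] ⊂ (0,1)`, all
`n ≥ 1` and `t ∈ [lo,hi]`: `0 < ∂_pΘ_n(p_c(t),t)` (the straight `x`-path of length `n` is pivotal
for `{0 ↔ ∂Λ_n}` with positive probability, and `p_c(t) ∈ (0,1)`). [Grimmett1999 §2.4;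
AizenmanGrimmett1991; ChayesSchonmann2000] -/
theorem stub_slopePositiveOnCurve :
    let μ := labelMeasure (Site 3)
    let vert : Sym2 (Site 3) → Prop := fun e => ∃ x : Site 3, e = s(x, x + Pi.single (2 : Fin 3) 1)
    let cfg : ℝ → ℝ → (Sym2 (Site 3) → ℝ) → Set (Sym2 (Site 3)) := fun p t U =>
      {e | e ∈ (zdGraph 3).edgeSet ∧ ((vert e ∧ U e ≤ t) ∨ (¬ vert e ∧ U e ≤ p))}
    let Θ : ℕ → ℝ → ℝ → ℝ := fun n p t => μ.real {U | cfg p t U ∈ siteToBoundary 3 n}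
    let θ : ℝ → ℝ → ℝ := fun p t => μ.real {U | cfg p t U ∈ percolatesAt (0 : Site 3)}
    let pc : ℝ → ℝ := fun t => sInf ({p : ℝ | 0 ≤ p ∧ p ≤ 1 ∧ 0 < θ p t} ∪ {1})
    ∀ lo hi : ℝ, 0 < lo → lo < hi → hi < 1 → ∀ n : ℕ, 1 ≤ n → ∀ t ∈ Set.Icc lo hi,
      0 < deriv (fun q => Θ n q t) (pc t) := by
  sorry

/-- Definitional consistency: the registered stubs prove their name-keyed statements. -/
example : Sig.stub_curveRatioLimit := stub_curveRatioLimit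
example : Sig.stub_subcritRatioEquicontinuity := stub_subcritRatioEquicontinuity
example : Sig.stub_slopePositiveOnCurve := stub_slopePositiveOnCurve

/-! ## §3 Proved plumbing -/

/-- STUB 3 is by-name support: it follows from the route items `ModelFacts` (conjunct 8: Russo
positivity of `∂_pΘ_n` on the open square for `n ≥ 1`) and `CriticalCurveRegular` (conjunct 2:
`0 < p_c(t) < 1` on `(0,1)`). -/
theorem slopePositiveOnCurve_of_items (hMF : ModelFacts) (hCC : CriticalCurveRegular) :
    SlopePositiveOnCurve := by
  obtain ⟨-, -, -, -, -, -, -, h8, -, -⟩ := hMF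
  obtain ⟨-, h2⟩ := hCC
  intro lo hi hlo _ hhi n hn t ht
  have ht' : t ∈ Set.Ioo (0 : ℝ) 1 := ⟨hlo.trans_le ht.1, ht.2.trans_lt hhi⟩
  exact h8 n hn (pcurve t) ⟨(h2 t ht').1, (h2 t ht').2⟩ t ht'

/-- **The percolation-free core of the composition** (`dT`, `dP`, `pc` abstract). From an
on-curve limit `|T − σD| ≤ (η/2)D`, an equicontinuity bound `|τD − Td| ≤ (η/2) d D` and `D > 0`:
`d ≥ 0` and `|τ − σ d| ≤ η d`. -/
theorem ratio_glue {dT dP : ℕ → ℝ → ℝ → ℝ} {pc : ℝ → ℝ} {lo hi : ℝ}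
    (h1 : ∃ σ : ℝ → ℝ, ContinuousOn σ (Set.Icc lo hi) ∧ ∀ η > (0 : ℝ), ∃ m : ℕ, ∀ n ≥ m,
      ∀ t ∈ Set.Icc lo hi, |dT n (pc t) t - σ t * dP n (pc t) t| ≤ η * dP n (pc t) t)
    (h2 : ∀ η > (0 : ℝ), ∃ δ > (0 : ℝ), ∃ m : ℕ, ∀ n ≥ m, ∀ t ∈ Set.Icc lo hi, ∀ p : ℝ,
      pc t - δ ≤ p → p ≤ pc t →
        |dT n p t * dP n (pc t) t - dT n (pc t) t * dP n p t| ≤ η * dP n p t * dP n (pc t) t)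
    (h3 : ∀ n : ℕ, 1 ≤ n → ∀ t ∈ Set.Icc lo hi, 0 < dP n (pc t) t) :
    ∃ σ : ℝ → ℝ, ContinuousOn σ (Set.Icc lo hi) ∧ ∀ η > (0 : ℝ), ∃ δ > (0 : ℝ), ∃ m : ℕ,
      ∀ n ≥ m, ∀ t ∈ Set.Icc lo hi, ∀ p : ℝ, pc t - δ ≤ p → p ≤ pc t →
        |dT n p t - σ t * dP n p t| ≤ η * dP n p t := by
  obtain ⟨σ, hσ, h1⟩ := h1
  refine ⟨σ, hσ, fun η hη => ?_⟩
  have hη2 : (0 : ℝ) < η / 2 := half_pos hη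
  obtain ⟨m₁, hm₁⟩ := h1 (η / 2) hη2
  obtain ⟨δ, hδ, m₂, hm₂⟩ := h2 (η / 2) hη2
  refine ⟨δ, hδ, max (max m₁ m₂) 1, fun n hn t ht p hp₁ hp₂ => ?_⟩
  have hn₁ : m₁ ≤ n := le_trans ((le_max_left _ _).trans (le_max_left _ _)) hn
  have hn₂ : m₂ ≤ n := le_trans ((le_max_right _ _).trans (le_max_left _ _)) hn
  have hn₃ : 1 ≤ n := le_trans (le_max_right _ _) hn
  have hD : 0 < dP n (pc t) t := h3 n hn₃ t ht
  have hA : |dT n (pc t) t - σ t * dP n (pc t) t| ≤ η / 2 * dP n (pc t) t := hm₁ n hn₁ t ht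
  have hB : |dT n p t * dP n (pc t) t - dT n (pc t) t * dP n p t| ≤
      η / 2 * dP n p t * dP n (pc t) t := hm₂ n hn₂ t ht p hp₁ hp₂
  -- abbreviations
  set D := dP n (pc t) t with hDdef
  set d := dP n p t with hddef
  set T := dT n (pc t) t with hTdef
  set τ := dT n p t with hτdef
  -- the equicontinuity inequality forces `d ≥ 0`
  have hd : 0 ≤ d := by
    by_contra hneg
    have hlt : d < 0 := not_le.mp hneg
    have h' : η / 2 * d * D < 0 := mul_neg_of_neg_of_pos (mul_neg_of_pos_of_neg hη2 hlt) hD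
    linarith [abs_nonneg (τ * D - T * d)]
  -- multiply the target by `D > 0` and split
  have key : |τ - σ t * d| * D ≤ η * d * D := by
    have e : (τ - σ t * d) * D = (τ * D - T * d) + d * (T - σ t * D) := by ring
    calc |τ - σ t * d| * D = |(τ - σ t * d) * D| := by rw [abs_mul, abs_of_pos hD]
      _ = |(τ * D - T * d) + d * (T - σ t * D)| := by rw [e]
      _ ≤ |τ * D - T * d| + |d * (T - σ t * D)| := abs_add_le _ _
      _ = |τ * D - T * d| + d * |T - σ t * D| := by rw [abs_mul d, abs_of_nonneg hd]
      _ ≤ η / 2 * d * D + d * (η / 2 * D) := add_le_add hB (mul_le_mul_of_nonneg_left hA hd)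
      _ = η * d * D := by ring
  exact le_of_mul_le_mul_right key hD

/-! ## §4 The composition (proved): the three stubs imply the crux BY NAME -/

/-- **`SubcritExchangeUniformity` from the three registered stubs** (hypotheses = the declared stub
`Prop`s by name; conclusion = the route decl `PercExchangeRateTransport.SubcritExchangeUniformity`
by name; no `sorry`): `σ` from STUB 1, `η/2 + η/2`, divided by `∂_pΘ_n(p_c(t),t) > 0` (STUB 3) via
`ratio_glue`. -/
theorem SubcritExchangeUniformity_of (h1 : Sig.stub_curveRatioLimit)
    (h2 : Sig.stub_subcritRatioEquicontinuity) (h3 : Sig.stub_slopePositiveOnCurve) :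
    Summit.CriticalPhenomena.PercolationContinuityZ3.Theses.PercExchangeRateTransport.SubcritExchangeUniformity := by
  have h1' : CurveRatioLimit := Sig.stub_curveRatioLimit_iff.1 h1
  have h2' : SubcritRatioEquicontinuity := Sig.stub_subcritRatioEquicontinuity_iff.1 h2
  have h3' : SlopePositiveOnCurve := Sig.stub_slopePositiveOnCurve_iff.1 h3
  rw [subcritExchangeUniformity_iff]
  intro lo hi hlo hlh hhi
  exact ratio_glue (dT := dT) (dP := dP) (pc := pcurve)
    (h1' lo hi hlo hlh hhi) (h2' lo hi hlo hlh hhi) (h3' lo hi hlo hlh hhi)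

/-- Wiring check: the registered stubs feed `SubcritExchangeUniformity_of` as stated — the skeleton
IS the crux proof once the three sorries go. -/
example :
    Summit.CriticalPhenomena.PercolationContinuityZ3.Theses.PercExchangeRateTransport.SubcritExchangeUniformity :=
  SubcritExchangeUniformity_of stub_curveRatioLimit stub_subcritRatioEquicontinuity
    stub_slopePositiveOnCurve

end Summit.CriticalPhenomena.PercolationContinuityZ3.Cruxes.SubcritExchangeUniformity.Birth

end
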